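import Mathlib
import HarnessLib
import Summits.ValiantsHypothesis.ValiantsHypothesis.Theorems.MonotoneRestorationNonnegRestorationQPSmlAffineSize

/-!
# MONOTONE column-set-multilinear `ΣΠΣ` circuits restore at quasi-polynomial SIZE
(route MonotoneRestoration, crux `MonotoneRestorationQP` stmt-ValiantsHypothesis-15886 — the mechanism crux: monotone
(nonnegative) computations of matrix-symmetric families ⇒ square-symmetric circuits of quasi-polynomial SIZE)

A MONOTONE depth-three circuit that is set-multilinear with respect to the columns computes, at level `n`,
`h n = Σ_{t<s} Π_{b<n} (β_{t,b} + Σ_a α_{t,b,a} x_{(a,b)})` with NONNEGATIVE reals `β, α` (no cancellations).  Its complexification is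
an affine column-set-multilinear `ΣΠΣ` expression over `ℂ` with the cast tables, so the size-currency stratum
`SmlAffineRestoration.nonneg_affineColSml_symmetricSize` applies:

* `map_monotoneColSml` — the complexification of a monotone column-sml expression is the complex affine column-sml expression
  with the cast coefficient tables;
* `monotoneColSml_symmetricSize` — **every matrix-symmetric family `h n ∈ ℝ≥0[x_ij]` given by monotone column-set-multilinear
  `ΣΠΣ` circuits with at most `n^c + c` product gates satisfies the CONCLUSION of `MonotoneRestorationQP` / `NonnegRestorationQP`:
  square-symmetric circuits over `ℂ` of SIZE `≤ 2^((log₂ n + c')^c')` computing `map (h n)`.**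

So the "order-exploiting monotone DP" feared by the crux's kill criterion cannot be a monotone column-set-multilinear depth-three
circuit.  Honest label: a stratum of the crux's conclusion on an explicit monotone circuit class (monotonicity is not even used —
the complex stratum allows cancellations); no registered stub of 15886 is closed; VP ≠ VNP untouched. [folklore]
-/

noncomputable section

open scoped Classical

-- `Summit.ValiantsHypothesis.ValiantsHypothesis.…` is the tree's single-conjunct layout (Sub = Summit).
set_option linter.dupNamespace false

namespace Summit.ValiantsHypothesis.ValiantsHypothesis.Theorems.SmlAffineRestoration

open MvPolynomial Finset Equiv Literature.Computability.AlgebraicComplexity OrbitRestorationQPDepthThreeRung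

/-- **Complexification of a monotone column-sml expression.** [folklore] -/
theorem map_monotoneColSml {n s : ℕ} (β : Fin s → Fin n → NNReal) (α : Fin s → Fin n → Fin n → NNReal) :
    MvPolynomial.map (Complex.ofRealHom.comp NNReal.toRealHom)
        (∑ t : Fin s, ∏ b : Fin n, (C (β t b) + ∑ a : Fin n, C (α t b a) * X (a, b)) : MvPolynomial (Fin n × Fin n) NNReal) =
      ∑ t : Fin s, ∏ b : Fin n, (C ((Complex.ofRealHom.comp NNReal.toRealHom) (β t b)) +
        ∑ a : Fin n, C ((Complex.ofRealHom.comp NNReal.toRealHom) (α t b a)) * X (a, b)) := by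
  simp only [map_sum, map_prod, map_add, map_mul, map_C, map_X]

/-- **MONOTONE COLUMN-SET-MULTILINEAR `ΣΠΣ` CIRCUITS RESTORE AT QUASI-POLYNOMIAL SIZE.**  A matrix-symmetric family over `ℝ≥0`
given by monotone column-set-multilinear depth-three circuits with at most `n^c + c` product gates has square-symmetric circuits
over `ℂ` of size `≤ 2^((log₂ n + c')^c')` computing its complexification — the conclusion of `MonotoneRestorationQP`
(stmt-ValiantsHypothesis-15886) and of `NonnegRestorationQP` (stmt-ValiantsHypothesis-16191) on this class. [folklore] -/
theorem monotoneColSml_symmetricSize (h : (n : ℕ) → MvPolynomial (Fin n × Fin n) NNReal)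
    (hsym : ∀ (n : ℕ) (σ τ : Equiv.Perm (Fin n)),
      MvPolynomial.rename (fun p : Fin n × Fin n => (σ p.1, τ p.2)) (h n) = h n)
    (hcirc : ∃ c : ℕ, ∀ n : ℕ, ∃ (s : ℕ) (β : Fin s → Fin n → NNReal) (α : Fin s → Fin n → Fin n → NNReal),
      s ≤ n ^ c + c ∧ h n = ∑ t : Fin s, ∏ b : Fin n, (C (β t b) + ∑ a : Fin n, C (α t b a) * X (a, b))) :
    ∃ c : ℕ, ∀ n : ℕ, ∃ (G : Type) (_ : Fintype G) (C : LabelledArithCircuit ℂ (Fin n × Fin n) Unit G),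
      C.IsSymmetric (Equiv.Perm (Fin n)) ∧
      C.eval (C.output ()) = MvPolynomial.map (Complex.ofRealHom.comp NNReal.toRealHom) (h n) ∧
      Fintype.card G ≤ 2 ^ ((Nat.log 2 n + c) ^ c) := by
  obtain ⟨c, hc⟩ := hcirc
  refine nonneg_affineColSml_symmetricSize h hsym ⟨c, fun n => ?_⟩
  obtain ⟨s, β, α, hs, hh⟩ := hc n
  exact ⟨s, fun t b => (Complex.ofRealHom.comp NNReal.toRealHom) (β t b),
    fun t b a => (Complex.ofRealHom.comp NNReal.toRealHom) (α t b a), hs, by rw [hh, map_monotoneColSml]⟩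

end Summit.ValiantsHypothesis.ValiantsHypothesis.Theorems.SmlAffineRestoration

end
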